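import Literature.AnabelianGeometry.EtaleTheta.Discharge.Sec5Prop53ChainModelZSupport
import Literature.AnabelianGeometry.EtaleTheta.FrobenioidThetaDivisorSupportIntersection
import HarnessLib

/-!
# [EtTh] §5, Prop. 5.3: the intersection-theory binder «principal ⟺ degree 0 on every component» HOLDS at the
# `ℤ`-chain witness of `DivisorSupportData'`, so the (iv)-criteria of the printed proof fire OUTRIGHT there

Mochizuki, *The étale theta function …*, Publ. RIMS **45** (2009), §5, proof of Prop. 5.3, p. 326 (PDF p. 100) ("the well-known
intersection theory of divisors supported on the chain of copies of the projective line"); §1 p. 240 (PDF p. 14) ("these degrees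
determine an isomorphism `Pic(𝔜_N) ⥲ ℤ^ℤ`") [cite: MochizukiEtTh2009, Prop 5.3 proof p.326 (PDF p.100)].  Cell abc-iut, layer L2
(self-named follow-on of ROWS #15d R287, abc-iut-L2-lead gen 4); seat abc-iut-w6-d061 (gen 4).  PROOF-ONLY companion of
`Sec5Prop53ChainModelZSupport.lean` (this seat: `chainSupportZ : DivisorSupportData' chainPrimeDataZ`, `Φ(A_⊚) = ∏_{ℤ⊔ℤ} ℤ_{≥0}`,
principal divisors `[(φ, −Δ²φ)]`) and of abc-iut-L6-d1's `FrobenioidThetaDivisorSupportR.lean` (the binder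
`DivisorSupportData'.PrincipalIffDegreeZero` = hypothesis `hInt` of GAP-LEDGER row G-L2d4-2) /
`FrobenioidThetaDivisorSupportIntersection.lean` (`cspToNcspCriterion'_of_degree`, `cspToNcspWitnessed'_of_principalIffDegreeZero`).

HERE: `degOn C_j [d] = d(C_{j−1}) − 2 d(C_j) + d(C_{j+1}) + d(x_j)` (one cusp over each component, `fibre_eq_singleton`); on a
principal divisor `[(φ, −Δ²φ)]` this is `Δ²φ(j) − Δ²φ(j) = 0`, and conversely an integer divisor `d` with all degrees `0` has cusp part
`−Δ²(d|_components)`, i.e. `d = D(d|_components)` is principal — so **`principalIffDegreeZero_chainSupportZ`**: the binder is a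
THEOREM at the witness (the law (L) IS the degree formula).  Consequences BY NAME: **`cspToNcspCriterion'_chainZ`**,
**`cspToNcspWitnessed'_chainZ`** — [EtTh] Prop. 5.3 (iv)'s printed description of `Prime^csp ↠ Prime^ncsp` holds outright at a
`DivisorSupportData'`-datum.  HONEST FRAMING: MODEL level; nothing here bears on [IUTchIII] Cor. 3.12; no side taken; typed ≠ proved.
-/

noncomputable section

namespace Literature.AnabelianGeometry.EtaleTheta.FrobenioidThetaDivisors.Prop53ChainZ

open CategoryTheory Literature.AlgebraicGeometry.Frobenioids ConstantMultiple ConstantMultiple.Cor512Toy Prop53Toy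
  Prop53Chain Sec3Prop34CnstOfRlfRChainModel

/-! ### Every element of `Φ(A_⊚)^gp` is an integer divisor `[d⁺]/[d⁻]` -/

/-- The integer coordinate vector of `x ∈ Φ(A_⊚)^gp`. [cite: MochizukiEtTh2009, Prop 3.2 (i) p.296 (PDF p.70)] -/
def coords (x : Algebra.GrothendieckGroup Φz) : Idx → ℤ := fun i => Multiplicative.toAdd (cZ i x)

/-- `x = [coords x⁺]/[coords x⁻]`. [cite: MochizukiEtTh2009, Prop 3.2 (i) p.296 (PDF p.70)] -/
theorem toGpZ_coords (x : Algebra.GrothendieckGroup Φz) : toGpZ (coords x) = x :=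
  eq_of_cZ_eq fun i => Multiplicative.toAdd.injective (by rw [toAdd_cZ_toGpZ]; rfl)

/-! ### Orders and degrees at the witness -/

/-- The order of `[d]` at `𝔭` is the coordinate `d(idx 𝔭)`. [cite: MochizukiEtTh2009, Prop 5.3 proof p.326 (PDF p.100)] -/
theorem ord_toGpZ (𝔭 : Primes chainThetaZ.PhiAcirc) (d : Idx → ℤ) : chainSupportZ.ord 𝔭 (toGpZ d) = (d (idxZ 𝔭) : ℚ) := by
  change Multiplicative.toAdd (ordGpOf' factorZ 𝔭 (toGpZ d)) = _
  rw [toGpZ, map_div, ordGpOf'_factorZ_of, ordGpOf'_factorZ_of, toAdd_div, toAdd_castQ, toAdd_castQ, posZ, negZ,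
    toAdd_ofAdd, toAdd_ofAdd]
  have h := Int.toNat_sub_toNat_neg (d (idxZ 𝔭))
  exact_mod_cast h

/-- The cusp over the component `𝔫 = C_j`: `x_j` (one cusp per component in the chain). [cite: MochizukiEtTh2009, Prop 5.3 (iv) p.325 (PDF p.99)] -/
def cuspOver (𝔫 : {p : Primes chainThetaZ.PhiAcirc // ¬ chainPrimeDataZ.IsCuspidal p}) :
    {p : Primes chainThetaZ.PhiAcirc // chainPrimeDataZ.IsCuspidal p} :=
  ⟨PZ (Sum.inr (labelZ 𝔫.1)), isCuspZ_PZ_inr _⟩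

/-- The fibre of `Prime^csp ↠ Prime^ncsp` over `C_j` is `{x_j}`. [cite: MochizukiEtTh2009, Prop 5.3 (iv) p.325 (PDF p.99)] -/
theorem fibre_eq_singleton (𝔫 : {p : Primes chainThetaZ.PhiAcirc // ¬ chainPrimeDataZ.IsCuspidal p}) :
    {𝔠 : {p : Primes chainThetaZ.PhiAcirc // chainPrimeDataZ.IsCuspidal p} | chainPrimeDataZ.cspToNcsp 𝔠 = 𝔫} =
      {cuspOver 𝔫} := by
  ext 𝔠
  simp only [Set.mem_setOf_eq, Set.mem_singleton_iff]
  constructor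
  · intro h
    apply Subtype.ext
    have h1 : PZ (Sum.inl (labelZ 𝔠.1)) = 𝔫.1 := congrArg Subtype.val h
    have h2 : labelZ 𝔠.1 = labelZ 𝔫.1 := by rw [← h1, labelZ_PZ_inl]
    change 𝔠.1 = PZ (Sum.inr (labelZ 𝔫.1))
    rw [← h2, PZ_inr_labelZ 𝔠.2]
  · rintro rfl
    apply Subtype.ext
    change PZ (Sum.inl (labelZ (PZ (Sum.inr (labelZ 𝔫.1))))) = 𝔫.1
    rw [labelZ_PZ_inr, PZ_inl_labelZ 𝔫.2]

/-- The neighbours of `C_j` in the chain are `C_{j+t}`. [cite: MochizukiEtTh2009, §1 p.239 (PDF p.13)] -/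
theorem ncspShift_val (t : ℤ) (𝔫 : {p : Primes chainThetaZ.PhiAcirc // ¬ chainPrimeDataZ.IsCuspidal p}) :
    (ncspShift chainPrimeDataZ t 𝔫).1 = PZ (Sum.inl (labelZ 𝔫.1 + t)) := rfl

/-- **The degree of an integer divisor on the component `C_j`**: `d(C_{j−1}) − 2 d(C_j) + d(C_{j+1}) + d(x_j)`.
[cite: MochizukiEtTh2009, §1 p.240 (PDF p.14)] -/
theorem degOn_toGpZ (𝔫 : {p : Primes chainThetaZ.PhiAcirc // ¬ chainPrimeDataZ.IsCuspidal p}) (d : Idx → ℤ) :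
    chainSupportZ.degOn 𝔫 (toGpZ d) =
      (d (Sum.inl (labelZ 𝔫.1 - 1)) : ℚ) - 2 * d (Sum.inl (labelZ 𝔫.1)) + d (Sum.inl (labelZ 𝔫.1 + 1)) + d (Sum.inr (labelZ 𝔫.1)) := by
  rw [DivisorSupportData'.degOn, fibre_eq_singleton, finsum_mem_singleton, ncspShift_val, ncspShift_val, ord_toGpZ, ord_toGpZ,
    ord_toGpZ, ord_toGpZ, idxZ_PZ, idxZ_PZ]
  have h𝔫 : idxZ 𝔫.1 = Sum.inl (labelZ 𝔫.1) := by
    conv_lhs => rw [← PZ_inl_labelZ 𝔫.2]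
    rw [idxZ_PZ]
  rw [h𝔫, show idxZ (cuspOver 𝔫).1 = Sum.inr (labelZ 𝔫.1) from idxZ_PZ _,
    show labelZ 𝔫.1 + -1 = labelZ 𝔫.1 - 1 by ring]

/-! ### The binder and the criteria -/

/-- **The intersection-theory binder HOLDS at the `ℤ`-chain witness**: an element of `Φ(A_⊚)^gp` is principal (`= [(φ, −Δ²φ)]`)
iff its degree on every component vanishes — the law (L) IS the degree formula. [cite: MochizukiEtTh2009, §1 p.240 (PDF p.14)] -/
theorem principalIffDegreeZero_chainSupportZ : chainSupportZ.PrincipalIffDegreeZero := by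
  intro x
  rw [chainSupportZ.isPrincipal_iff_mem]
  change x ∈ prinHom.range ↔ _
  constructor
  · rintro ⟨φm, rfl⟩ 𝔫
    rw [prinHom_apply, degOn_toGpZ, D_inl, D_inl, D_inl, D_inr, lap]
    push_cast
    ring
  · intro h
    -- the component coordinates give the rational function
    refine ⟨Multiplicative.ofAdd (fun j : ℤ => coords x (Sum.inl j)), ?_⟩
    rw [prinHom_apply, toAdd_ofAdd]
    refine Eq.trans ?_ (toGpZ_coords x)
    congr 1
    funext i
    rcases i with j | j
    · rfl
    · have hj := h ⟨PZ (Sum.inl j), not_isCuspZ_PZ_inl j⟩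
      rw [← toGpZ_coords x, degOn_toGpZ, labelZ_PZ_inl] at hj
      rw [D_inr, lap]
      have hj' : (coords x (Sum.inl (j - 1)) : ℤ) - 2 * coords x (Sum.inl j) + coords x (Sum.inl (j + 1)) +
          coords x (Sum.inr j) = 0 := by exact_mod_cast hj
      linarith

/-- **[EtTh] Prop. 5.3 (iv), the p.326 description of `Prime^csp ↠ Prime^ncsp`, OUTRIGHT at the `ℤ`-chain witness** (abc-iut-L6-d1's
`cspToNcspCriterion'_of_degree` with its degree hypothesis discharged). [cite: MochizukiEtTh2009, Prop 5.3 proof p.326 (PDF p.100)] -/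
theorem cspToNcspCriterion'_chainZ : CspToNcspCriterion' chainSupportZ :=
  chainSupportZ.cspToNcspCriterion'_of_degree fun x hx 𝔪 => (principalIffDegreeZero_chainSupportZ x).mp hx 𝔪

/-- **[EtTh] Prop. 5.3 (iv), the p.326 configuration at every cusp, OUTRIGHT at the `ℤ`-chain witness** (abc-iut-L6-d1's
`cspToNcspWitnessed'_of_principalIffDegreeZero` with the binder discharged). [cite: MochizukiEtTh2009, Prop 5.3 proof p.326 (PDF p.100)] -/
theorem cspToNcspWitnessed'_chainZ : CspToNcspWitnessed' chainSupportZ :=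
  chainSupportZ.cspToNcspWitnessed'_of_principalIffDegreeZero principalIffDegreeZero_chainSupportZ

/-- **NON-VACUITY with the binder**: a `DivisorSupportData'` datum satisfying `PrincipalIffDegreeZero` exists.
[cite: MochizukiEtTh2009, Prop 5.3 proof p.326 (PDF p.100)] -/
theorem exists_divisorSupportData'_principalIffDegreeZero :
    ∃ 𝔖 : DivisorSupportData' chainPrimeDataZ, 𝔖.PrincipalIffDegreeZero :=
  ⟨chainSupportZ, principalIffDegreeZero_chainSupportZ⟩

end Literature.AnabelianGeometry.EtaleTheta.FrobenioidThetaDivisors.Prop53ChainZ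

end
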